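import Mathlib
import Literature.NumberTheory.ModularForms.LevelThreeReduction
import Literature.NumberTheory.ModularForms.LevelTwoThetaForms
import Literature.NumberTheory.EllipticCurves.ModularFormsGamma0FreeModule
import Literature.NumberTheory.ModularForms.QuasimodularPhi
import Literature.NumberTheory.ModularForms.ModerateGrowth
import Literature.NumberTheory.EllipticCurves.ModularFormsRamanujan
import Literature.NumberTheory.EllipticCurves.ModularCurveEtaMultiplierProofs
import Literature.NumberTheory.EllipticCurves.ModularCurveEtaProductsProofs
import Literature.NumberTheory.EllipticCurves.EisensteinValuesAtRho
import Literature.NumberTheory.ModularForms.EisensteinE4Hypergeometric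
import Literature.NumberTheory.Automorphic.ZhouLegendreGreenValues
import Literature.NumberTheory.EllipticCurves.WeberGamma2
import HarnessLib

/-!
# The level-`3` forms `𝓟 = (3E₂(3τ) − E₂(τ))/2`, `Δ₃ = (η(τ)η(3τ))⁶` and the weight-4 quotient `f₃ = Δ₃/𝓟`

[topic NumberTheory/ModularForms]

Level-`3` analogues of the level-2 objects of `LevelTwoThetaForms.lean`, for the group
`Γ₀(3)⁺ = ⟨T, W₃⟩` (`W₃ : τ ↦ −1/(3τ)`, `frickeThree` of `LevelThreeReduction.lean`), built from
Mathlib's quasimodular `E₂` (`EisensteinSeries.E2`, transformation law `E2_slash_action`) and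
Dedekind's `η` (`ModularForm.eta`):

* `eisThree τ := (3E₂(3τ) − E₂(τ))/2` (the weight-2 Eisenstein series of `Γ₀(3)`,
  `1 + 12∑(σ(n) − 3σ(n/3))qⁿ`) and `deltaThree τ := (η(τ)η(3τ))⁶` (the weight-6 cusp form of
  `Γ₀(3)`), with **`𝓟(τ+1) = 𝓟(τ)`, `𝓟(−1/(3τ)) = −3τ²𝓟(τ)`, `Δ₃(τ+1) = Δ₃(τ)`,
  `Δ₃(−1/(3τ)) = −27τ⁶Δ₃(τ)`** (`eisThree_fricke`, `deltaThree_fricke`; from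
  `E₂(−1/z) = z²E₂(z) − 6iz/π` and `η(−1/z) = e^{−πi/4}√z η(z)`);
* the weight-`4` meromorphic form **`fThree := Δ₃/𝓟`** with `f₃(τ+1) = f₃(τ)`,
  `f₃(−1/(3τ)) = 9τ⁴ f₃(τ)` (`fThree_fricke`), the level-3 analogue of `Δ/E₄²` and `Δ₂/𝓔²` used
  for the CM value `G₂^{Γ₀(3)}((3+i√3)/6, i/√3)` of Zhou 2015, Remark 9;
* holomorphy of `𝓟 ∘ ofComplex`, `Δ₃ ∘ ofComplex` on the upper half-plane and the limits
  `𝓟 → 1`, `Δ₃ → 0` at `i∞`.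

The zero locus of `𝓟` (double zeros exactly on the orbit of the corner `(3 + i√3)/6`) is treated in
a sequel.

## References
* H. Cohn, A. Kumar, S. D. Miller, D. Radchenko, M. Viazovska, Ann. of Math. 196 (2022), §2.1.1
  (2.4) (`E₂` under `S`). [cite: CohnEtAl2019, §2.1.1 (2.4)]
* Y. Zhou, Ramanujan J. 38 (2015), Remark 9 (level `3`) and eq. (P_nu_sqr_E2_diff)
  (`[P_{−1/3}(1−2α₃)]² = (3E₂(3z) − E₂(z))/2`). [cite: Zhou2015, Remark 9]
-/

noncomputable section

open Complex hiding I
open UpperHalfPlane hiding I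
open Filter Topology ModularForm EisensteinSeries Real
open scoped MatrixGroups ModularForm Manifold

namespace Literature.NumberTheory.ModularForms

open Literature.NumberTheory.EllipticCurves.ModularForms (eta_S_smul csqrt_sq tendsto_E2_atImInfty eta_add_one
  mulThree coe_mulThree)

/-! ## The points `3τ`, `−1/(3τ)` -/

/-- Height of `3τ`. [folklore] -/
theorem mulThree_im (τ : ℍ) : (mulThree τ).im = 3 * τ.im := by
  rw [← UpperHalfPlane.coe_im, coe_mulThree, Complex.mul_im]; simp

/-- `W₃ τ = S • (3τ)`. [folklore] -/
theorem frickeThree_eq_S_smul (τ : ℍ) : frickeThree τ = ModularGroup.S • mulThree τ := by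
  apply UpperHalfPlane.ext
  rw [coe_frickeThree, UpperHalfPlane.modular_S_smul]
  show -1 / (3 * (τ : ℂ)) = (-((mulThree τ : ℍ) : ℂ))⁻¹
  rw [coe_mulThree, inv_neg, neg_div, one_div]

/-- `3 · W₃ τ = S • τ`. [folklore] -/
theorem mulThree_frickeThree (τ : ℍ) : mulThree (frickeThree τ) = ModularGroup.S • τ := by
  apply UpperHalfPlane.ext
  rw [coe_mulThree, coe_frickeThree, UpperHalfPlane.modular_S_smul]
  show 3 * (-1 / (3 * (τ : ℂ))) = (-(τ : ℂ))⁻¹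
  have hτ : (τ : ℂ) ≠ 0 := τ.ne_zero
  field_simp

/-- `3(τ + 1) = 3τ + 3`. [folklore] -/
theorem mulThree_vadd_one (τ : ℍ) : mulThree ((1 : ℝ) +ᵥ τ) = (1 : ℝ) +ᵥ ((1 : ℝ) +ᵥ ((1 : ℝ) +ᵥ mulThree τ)) := by
  apply UpperHalfPlane.ext
  simp only [coe_mulThree, UpperHalfPlane.coe_vadd]
  push_cast; ring

/-- `3τ → i∞` as `τ → i∞`. [folklore] -/
theorem tendsto_mulThree_atImInfty : Tendsto mulThree atImInfty atImInfty := by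
  rw [atImInfty, tendsto_comap_iff]
  have : (UpperHalfPlane.im ∘ mulThree) = fun τ => 3 * τ.im := funext fun τ => mulThree_im τ
  rw [this]
  exact Filter.Tendsto.const_mul_atTop three_pos tendsto_comap

/-! ## `𝓟` and `Δ₃` -/

/-- **`𝓟(τ) := (3E₂(3τ) − E₂(τ))/2`**, the weight-2 Eisenstein series of `Γ₀(3)`. [cite: Zhou2015, eq. (P_nu_sqr_E2_diff)] -/
def eisThree (τ : ℍ) : ℂ := (3 * E2 (mulThree τ) - E2 τ) / 2

/-- **`Δ₃(τ) := (η(τ)η(3τ))⁶`**, the weight-6 cusp form of `Γ₀(3)`. [folklore] -/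
def deltaThree (τ : ℍ) : ℂ := (η (τ : ℂ) * η ((mulThree τ : ℍ) : ℂ)) ^ 6

/-- `𝓟(τ + 1) = 𝓟(τ)`. [folklore] -/
theorem eisThree_vadd_one (τ : ℍ) : eisThree ((1 : ℝ) +ᵥ τ) = eisThree τ := by
  rw [eisThree, eisThree, mulThree_vadd_one, E2_vadd_one, E2_vadd_one, E2_vadd_one, E2_vadd_one]

/-- **`𝓟(−1/(3τ)) = −3τ²𝓟(τ)`** (from `E₂(−1/z) = z²E₂(z) − 6iz/π` at `z = 3τ` and `z = τ`). [cite: CohnEtAl2019, §2.1.1 (2.4)] -/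
theorem eisThree_fricke (τ : ℍ) : eisThree (frickeThree τ) = -3 * (τ : ℂ) ^ 2 * eisThree τ := by
  rw [eisThree, eisThree, mulThree_frickeThree, frickeThree_eq_S_smul, E2_S_smul, E2_S_smul, coe_mulThree]
  have hπ : (π : ℂ) ≠ 0 := by exact_mod_cast Real.pi_ne_zero
  field_simp
  ring

/-- `η(z + 3) = e^{2πi/8}η(z)`, i.e. `η(3(τ+1)) = e^{6πi/24}η(3τ)`. [folklore] -/
theorem eta_add_three (z : ℂ) : η (z + 3) = cexp (2 * π * Complex.I / 24) ^ 3 * η z := by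
  rw [show z + 3 = z + 1 + 1 + 1 by ring, eta_add_one, eta_add_one, eta_add_one]
  ring

/-- `Δ₃(τ + 1) = Δ₃(τ)`. [folklore] -/
theorem deltaThree_vadd_one (τ : ℍ) : deltaThree ((1 : ℝ) +ᵥ τ) = deltaThree τ := by
  rw [deltaThree, deltaThree]
  have h1 : (((1 : ℝ) +ᵥ τ : ℍ) : ℂ) = (τ : ℂ) + 1 := by rw [UpperHalfPlane.coe_vadd]; push_cast; ring
  have h3 : ((mulThree ((1 : ℝ) +ᵥ τ) : ℍ) : ℂ) = ((mulThree τ : ℍ) : ℂ) + 3 := by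
    rw [coe_mulThree, coe_mulThree, UpperHalfPlane.coe_vadd]; push_cast; ring
  rw [h1, h3, eta_add_one, eta_add_three]
  have hexp : (cexp (2 * π * Complex.I / 24) * (cexp (2 * π * Complex.I / 24)) ^ 3) ^ 6 = 1 := by
    rw [← pow_succ', ← pow_mul, ← Complex.exp_nat_mul]
    norm_num
    rw [show (24 : ℂ) * (2 * π * Complex.I / 24) = 2 * π * Complex.I by ring, Complex.exp_two_pi_mul_I]
  calc (cexp (2 * π * Complex.I / 24) * η τ * (cexp (2 * π * Complex.I / 24) ^ 3 * η (mulThree τ))) ^ 6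
      = (cexp (2 * π * Complex.I / 24) * (cexp (2 * π * Complex.I / 24)) ^ 3) ^ 6 * (η τ * η (mulThree τ)) ^ 6 := by ring
    _ = (η τ * η (mulThree τ)) ^ 6 := by rw [hexp, one_mul]

/-- `e^{−3πi} = −1`: `(e^{−πi/4})¹² = −1`. [folklore] -/
theorem cexp_neg_pi_I_div_four_pow_twelve : cexp (-(π * Complex.I / 4)) ^ 12 = -1 := by
  rw [← Complex.exp_nat_mul, show ((12 : ℕ) : ℂ) * -(π * Complex.I / 4) = -(π * Complex.I) - 2 * π * Complex.I by
    push_cast; ring, Complex.exp_sub, Complex.exp_two_pi_mul_I, div_one, Complex.exp_neg, Complex.exp_pi_mul_I]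
  norm_num

/-- **`Δ₃(−1/(3τ)) = −27τ⁶Δ₃(τ)`** (from `η(−1/z) = e^{−πi/4}√z η(z)` at `z = 3τ` and `z = τ`). [folklore] -/
theorem deltaThree_fricke (τ : ℍ) : deltaThree (frickeThree τ) = -27 * (τ : ℂ) ^ 6 * deltaThree τ := by
  rw [deltaThree, deltaThree, mulThree_frickeThree, frickeThree_eq_S_smul, eta_S_smul, eta_S_smul, coe_mulThree]
  have h3 : Complex.sqrt (3 * (τ : ℂ)) ^ 6 = (3 * (τ : ℂ)) ^ 3 := by
    rw [show (6 : ℕ) = 2 * 3 from rfl, pow_mul, csqrt_sq]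
  have h1 : Complex.sqrt (τ : ℂ) ^ 6 = (τ : ℂ) ^ 3 := by
    rw [show (6 : ℕ) = 2 * 3 from rfl, pow_mul, csqrt_sq]
  have he := cexp_neg_pi_I_div_four_pow_twelve
  calc (cexp (-(π * Complex.I / 4)) * Complex.sqrt (3 * (τ : ℂ)) * η (mulThree τ) *
        (cexp (-(π * Complex.I / 4)) * Complex.sqrt (τ : ℂ) * η τ)) ^ 6
      = cexp (-(π * Complex.I / 4)) ^ 12 * (Complex.sqrt (3 * (τ : ℂ)) ^ 6 * Complex.sqrt (τ : ℂ) ^ 6) *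
          (η τ * η (mulThree τ)) ^ 6 := by ring
    _ = -27 * (τ : ℂ) ^ 6 * (η τ * η (mulThree τ)) ^ 6 := by rw [he, h3, h1]; ring

/-! ## The weight-4 meromorphic form `f₃ = Δ₃/𝓟` -/

/-- **`f₃ := Δ₃/𝓟`** (junk `0` at the zeros of `𝓟`). [folklore] -/
def fThree (τ : ℍ) : ℂ := deltaThree τ / eisThree τ

/-- `f₃(τ + 1) = f₃(τ)`. [folklore] -/
theorem fThree_vadd_one (τ : ℍ) : fThree ((1 : ℝ) +ᵥ τ) = fThree τ := by
  rw [fThree, fThree, deltaThree_vadd_one, eisThree_vadd_one]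

/-- **`f₃(−1/(3τ)) = 9τ⁴ f₃(τ)`** (weight `4` for `W₃`: `−27τ⁶/(−3τ²) = 9τ⁴`). [folklore] -/
theorem fThree_fricke (τ : ℍ) : fThree (frickeThree τ) = 9 * (τ : ℂ) ^ 4 * fThree τ := by
  rw [fThree, fThree, deltaThree_fricke, eisThree_fricke]
  rcases eq_or_ne (eisThree τ) 0 with h | h
  · simp [h]
  · have hτ : (τ : ℂ) ≠ 0 := τ.ne_zero
    field_simp
    ring

/-! ## Behaviour at `i∞` and holomorphy -/

/-- `𝓟 → 1` at `i∞`. [folklore] -/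
theorem tendsto_eisThree : Tendsto eisThree atImInfty (𝓝 1) := by
  have h3 : Tendsto (fun τ => E2 (mulThree τ)) atImInfty (𝓝 1) := tendsto_E2_atImInfty.comp tendsto_mulThree_atImInfty
  have h := ((h3.const_mul 3).sub tendsto_E2_atImInfty).div_const 2
  rw [show ((3 : ℂ) * 1 - 1) / 2 = 1 by norm_num] at h
  exact h.congr fun τ => rfl

/-- `Δ → 0` at `i∞` for Mathlib's `Δ = η²⁴`. [folklore] -/
theorem tendsto_discriminant_atImInfty' : Tendsto ModularForm.discriminant atImInfty (𝓝 0) := by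
  have h : IsZeroAtImInfty (CuspForm.discriminant : ℍ → ℂ) := CuspFormClass.zero_at_infty CuspForm.discriminant
  exact h

/-- `η(τ) → 0` at `i∞` (`|η|²⁴ = |Δ| → 0`). [folklore] -/
theorem tendsto_eta_atImInfty : Tendsto (fun τ : ℍ => η (τ : ℂ)) atImInfty (𝓝 0) := by
  have h := tendsto_discriminant_atImInfty'.norm
  rw [norm_zero] at h
  have h24 : Tendsto (fun τ : ℍ => ‖η (τ : ℂ)‖ ^ 24) atImInfty (𝓝 0) := by
    refine h.congr fun τ => ?_
    rw [ModularForm.discriminant, norm_pow]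
  have hroot : Tendsto (fun x : ℝ => x ^ (1 / 24 : ℝ)) (𝓝 0) (𝓝 0) := by
    have := (Real.continuousAt_rpow_const 0 (1 / 24) (Or.inr (by norm_num))).tendsto
    rwa [Real.zero_rpow (by norm_num)] at this
  have h1 : Tendsto (fun τ : ℍ => (‖η (τ : ℂ)‖ ^ 24) ^ (1 / 24 : ℝ)) atImInfty (𝓝 0) := hroot.comp h24
  have h2 : ∀ τ : ℍ, (‖η (τ : ℂ)‖ ^ 24) ^ (1 / 24 : ℝ) = ‖η (τ : ℂ)‖ := fun τ => by
    rw [← Real.rpow_natCast, ← Real.rpow_mul (norm_nonneg _)]; norm_num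
  simp_rw [h2] at h1
  exact tendsto_zero_iff_norm_tendsto_zero.mpr h1

/-- `Δ₃ → 0` at `i∞`. [folklore] -/
theorem tendsto_deltaThree : Tendsto deltaThree atImInfty (𝓝 0) := by
  have h1 := tendsto_eta_atImInfty
  have h3 : Tendsto (fun τ : ℍ => η ((mulThree τ : ℍ) : ℂ)) atImInfty (𝓝 0) :=
    tendsto_eta_atImInfty.comp tendsto_mulThree_atImInfty
  have h := (h1.mul h3).pow 6
  rw [mul_zero, zero_pow (by norm_num)] at h
  exact h.congr fun τ => rfl

/-- `f₃ → 0` at `i∞`. [folklore] -/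
theorem tendsto_fThree_atImInfty : Tendsto fThree atImInfty (𝓝 0) := by
  have h := tendsto_deltaThree.div tendsto_eisThree one_ne_zero
  rw [zero_div] at h
  exact h.congr fun τ => rfl

/-- `E₂ ∘ ofComplex` is holomorphic on the upper half-plane. [folklore] -/
theorem differentiableAt_E2_ofComplex {w : ℂ} (hw : 0 < w.im) : DifferentiableAt ℂ (E2 ∘ ofComplex) w :=
  (UpperHalfPlane.mdifferentiable_iff.mp E2_mdifferentiable).differentiableAt (isOpen_upperHalfPlaneSet.mem_nhds hw)

/-- `mulThree` through `ofComplex`. [folklore] -/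
theorem mulThree_ofComplex {w : ℂ} (hw : 0 < w.im) : mulThree (ofComplex w) = ofComplex (3 * w) := by
  have hw' : 0 < (3 * w).im := by simpa using hw
  apply UpperHalfPlane.ext
  rw [coe_mulThree, ofComplex_apply_of_im_pos hw, ofComplex_apply_of_im_pos hw']

/-- **`𝓟 ∘ ofComplex` is holomorphic on the upper half-plane.** [folklore] -/
theorem differentiableAt_eisThree {w : ℂ} (hw : 0 < w.im) : DifferentiableAt ℂ (eisThree ∘ ofComplex) w := by
  have hw3 : 0 < (3 * w).im := by simpa using hw
  have h1 := differentiableAt_E2_ofComplex hw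
  have h3 : DifferentiableAt ℂ (fun u : ℂ => (E2 ∘ ofComplex) (3 * u)) w :=
    (differentiableAt_E2_ofComplex hw3).comp w (differentiableAt_id.const_mul _)
  have h := ((h3.const_mul 3).sub h1).div_const 2
  refine h.congr_of_eventuallyEq ?_
  filter_upwards [isOpen_upperHalfPlaneSet.mem_nhds hw] with u hu
  simp only [Function.comp_apply, Pi.sub_apply, eisThree, mulThree_ofComplex hu]

/-- **`Δ₃ ∘ ofComplex` is holomorphic on the upper half-plane.** [folklore] -/
theorem differentiableAt_deltaThree {w : ℂ} (hw : 0 < w.im) : DifferentiableAt ℂ (deltaThree ∘ ofComplex) w := by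
  have hw3 : 0 < (3 * w).im := by simpa using hw
  have h1 : DifferentiableAt ℂ η w := ModularForm.differentiableAt_eta_of_mem_upperHalfPlaneSet hw
  have h3 : DifferentiableAt ℂ (fun u : ℂ => η (3 * u)) w :=
    (ModularForm.differentiableAt_eta_of_mem_upperHalfPlaneSet hw3).comp w (differentiableAt_id.const_mul _)
  have h := (h1.mul h3).pow 6
  refine h.congr_of_eventuallyEq ?_
  filter_upwards [isOpen_upperHalfPlaneSet.mem_nhds hw] with u hu
  simp only [Function.comp_apply, Pi.pow_apply, Pi.mul_apply, deltaThree, coe_mulThree, ofComplex_apply_of_im_pos hu]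

/-- `Δ₃ ≠ 0` on `ℍ`. [folklore] -/
theorem deltaThree_ne_zero (τ : ℍ) : deltaThree τ ≠ 0 := by
  rw [deltaThree]
  exact pow_ne_zero _ (mul_ne_zero (ModularForm.eta_ne_zero τ.2) (ModularForm.eta_ne_zero (mulThree τ).2))

/-! ## The corner `c₃ = (3 + i√3)/6`: `𝓟(c₃) = 0` -/

section Corner

open Literature.NumberTheory.Automorphic (cmLevelThree)
open Literature.NumberTheory.EllipticCurves.ModularForms (E2_rho)

/-- Coordinates of `cmLevelThree`. [folklore] -/
theorem coe_cmLevelThree : ((cmLevelThree : ℍ) : ℂ) = ⟨1 / 2, Real.sqrt 3 / 6⟩ := rfl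

/-- `3c₃ = 2 + ρ = 1 +ᵥ (1 +ᵥ ρ)`. [folklore] -/
theorem mulThree_cmLevelThree : mulThree cmLevelThree = (1 : ℝ) +ᵥ ((1 : ℝ) +ᵥ UpperHalfPlane.ρ) := by
  apply UpperHalfPlane.ext
  rw [coe_mulThree, coe_cmLevelThree, UpperHalfPlane.coe_vadd, UpperHalfPlane.coe_vadd]
  apply Complex.ext <;> (simp [UpperHalfPlane.ρ]; ring)

/-- The auxiliary point `w = ρ − 1 = (−3 + i√3)/2` (`|w|² = 3`, `−1/w = c₃`). [folklore] -/
def wPt : ℍ := (-1 : ℝ) +ᵥ UpperHalfPlane.ρ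

/-- Coordinates of `w`. [folklore] -/
theorem coe_wPt : ((wPt : ℍ) : ℂ) = ⟨-3 / 2, Real.sqrt 3 / 2⟩ := by
  rw [wPt, UpperHalfPlane.coe_vadd]
  apply Complex.ext
  · simp [UpperHalfPlane.ρ]; ring
  · simp [UpperHalfPlane.ρ]

/-- `1 +ᵥ w = ρ`. [folklore] -/
theorem one_vadd_wPt : (1 : ℝ) +ᵥ wPt = UpperHalfPlane.ρ := by
  rw [wPt, vadd_vadd]; simp

/-- **`c₃ = S • w`** (`−1/(ρ − 1) = (3 + i√3)/6`). [folklore] -/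
theorem cmLevelThree_eq_S_smul_wPt : cmLevelThree = ModularGroup.S • wPt := by
  apply UpperHalfPlane.ext
  rw [UpperHalfPlane.modular_S_smul]
  show ((cmLevelThree : ℍ) : ℂ) = (-((wPt : ℍ) : ℂ))⁻¹
  rw [coe_cmLevelThree, coe_wPt, eq_comm]
  have hs : Real.sqrt 3 * Real.sqrt 3 = 3 := Real.mul_self_sqrt (by norm_num)
  apply inv_eq_of_mul_eq_one_right
  apply Complex.ext
  · simp [Complex.mul_re]; nlinarith [hs]
  · simp [Complex.mul_im]; ring

/-- `E₂(3c₃) = E₂(ρ) = 2√3/π`. [cite: CohnEtAl2019, §2.1.1 (2.4)] -/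
theorem E2_mulThree_cmLevelThree : E2 (mulThree cmLevelThree) = 2 * (Real.sqrt 3 : ℝ) / π := by
  rw [mulThree_cmLevelThree, E2_vadd_one, E2_vadd_one, E2_rho]

/-- `E₂(w) = E₂(ρ)`. [folklore] -/
theorem E2_wPt : E2 wPt = 2 * (Real.sqrt 3 : ℝ) / π := by
  rw [← E2_rho, ← one_vadd_wPt, E2_vadd_one]

/-- **`E₂(c₃) = 6√3/π`** (`E₂(−1/w) = w²E₂(w) − 6iw/π` at `w = ρ − 1`). [cite: CohnEtAl2019, §2.1.1 (2.4)] -/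
theorem E2_cmLevelThree : E2 cmLevelThree = 6 * (Real.sqrt 3 : ℝ) / π := by
  rw [cmLevelThree_eq_S_smul_wPt, E2_S_smul, E2_wPt, coe_wPt]
  have hπ : (π : ℂ) ≠ 0 := by exact_mod_cast Real.pi_ne_zero
  have hs : Real.sqrt 3 * Real.sqrt 3 = 3 := Real.mul_self_sqrt (by norm_num)
  field_simp
  apply Complex.ext
  · simp [Complex.mul_re, Complex.mul_im]; nlinarith [hs]
  · simp [Complex.mul_re, Complex.mul_im]; nlinarith [hs]

/-- **`𝓟(c₃) = 0`**: `3E₂(3c₃) = 6√3/π = E₂(c₃)`. [cite: Zhou2015, Remark 9] -/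
theorem eisThree_cmLevelThree : eisThree cmLevelThree = 0 := by
  rw [eisThree, E2_mulThree_cmLevelThree, E2_cmLevelThree]
  ring

/-- `E₄(3c₃) = 0` and `E₄(c₃) = 0` (both `3c₃ = T²ρ` and `c₃ = ST⁻¹ρ` lie in the orbit of `ρ`). [folklore] -/
theorem E₄_mulThree_cmLevelThree : E₄ (mulThree cmLevelThree) = 0 ∧ E₄ cmLevelThree = 0 := by
  constructor
  · rw [mulThree_cmLevelThree]
    have h : (1 : ℝ) +ᵥ ((1 : ℝ) +ᵥ UpperHalfPlane.ρ) = (ModularGroup.T * ModularGroup.T) • UpperHalfPlane.ρ := by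
      rw [mul_smul, ← UpperHalfPlane.modular_T_smul, ← UpperHalfPlane.modular_T_smul]
    rw [h]
    exact Literature.NumberTheory.EllipticCurves.ModularForms.E₄_eq_zero_iff.mpr ⟨_, rfl⟩
  · rw [cmLevelThree_eq_S_smul_wPt, wPt]
    have h : (-1 : ℝ) +ᵥ UpperHalfPlane.ρ = ModularGroup.T⁻¹ • UpperHalfPlane.ρ := by
      have := UpperHalfPlane.modular_T_zpow_smul UpperHalfPlane.ρ (-1)
      rw [zpow_neg_one] at this
      rw [this]; norm_num
    rw [h, ← mul_smul]
    exact Literature.NumberTheory.EllipticCurves.ModularForms.E₄_eq_zero_iff.mpr ⟨_, rfl⟩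

end Corner

/-! ## Derivatives of `𝓟` at the corner: `𝓟'(c₃) = 0`, `𝓟''(c₃) = −3π²E₆(ρ)` -/

section CornerDerivatives

open Literature.NumberTheory.Automorphic (cmLevelThree)
open Literature.NumberTheory.EllipticCurves.ModularForms (E2_rho deriv_comp_ofComplex_eq normalizedDeriv_E₄
  levelOne_apply_smul)

/-- `F := E₂ ∘ ofComplex`. [folklore] -/
def FE2 (u : ℂ) : ℂ := (E2 ∘ ofComplex) u

/-- `G := E₄ ∘ ofComplex`. [folklore] -/
def GE4 (u : ℂ) : ℂ := ((E₄ : ℍ → ℂ) ∘ ofComplex) u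

/-- `H := E₆ ∘ ofComplex`. [folklore] -/
def HE6 (u : ℂ) : ℂ := ((E₆ : ℍ → ℂ) ∘ ofComplex) u

/-- Ramanujan: `F' = 2πi·(F² − G)/12`. [cite: NesterenkoPhilippon2001, Ch. 3 §1 (2)] -/
def FE2' (u : ℂ) : ℂ := 2 * π * Complex.I * (12⁻¹ * (FE2 u * FE2 u - GE4 u))

/-- Ramanujan: `G' = 2πi·(FG − H)/3`. [cite: NesterenkoPhilippon2001, Ch. 3 §1 (2)] -/
def GE4' (u : ℂ) : ℂ := 2 * π * Complex.I * (3⁻¹ * (FE2 u * GE4 u - HE6 u))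

/-- **`(E₂ ∘ ofComplex)' = 2πi(E₂² − E₄)/12`** on the upper half-plane. [cite: NesterenkoPhilippon2001, Ch. 3 §1 (2)] -/
theorem hasDerivAt_FE2 {u : ℂ} (hu : 0 < u.im) : HasDerivAt FE2 (FE2' u) u := by
  have hd : DifferentiableAt ℂ FE2 u := differentiableAt_E2_ofComplex hu
  refine hd.hasDerivAt.congr_deriv ?_
  have h := deriv_comp_ofComplex_eq E2 (ofComplex u)
  rw [ofComplex_apply_of_im_pos hu] at h
  change deriv FE2 u = _ at h
  rw [h, normalizedDeriv_E2, FE2', FE2, GE4]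
  simp only [Function.comp_apply, ofComplex_apply_of_im_pos hu]

/-- **`(E₄ ∘ ofComplex)' = 2πi(E₂E₄ − E₆)/3`** on the upper half-plane. [cite: NesterenkoPhilippon2001, Ch. 3 §1 (2)] -/
theorem hasDerivAt_GE4 {u : ℂ} (hu : 0 < u.im) : HasDerivAt GE4 (GE4' u) u := by
  have hd : DifferentiableAt ℂ GE4 u :=
    (UpperHalfPlane.mdifferentiable_iff.mp (ModularFormClass.holo E₄)).differentiableAt (isOpen_upperHalfPlaneSet.mem_nhds hu)
  refine hd.hasDerivAt.congr_deriv ?_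
  have h := deriv_comp_ofComplex_eq (E₄ : ℍ → ℂ) (ofComplex u)
  rw [ofComplex_apply_of_im_pos hu] at h
  change deriv GE4 u = _ at h
  rw [h, normalizedDeriv_E₄, GE4', FE2, GE4, HE6]
  simp only [Function.comp_apply, ofComplex_apply_of_im_pos hu]

/-- The first derivative of `𝓟 ∘ ofComplex`: `P₁(u) = (9F'(3u) − F'(u))/2`. [folklore] -/
def PE1 (u : ℂ) : ℂ := (9 * FE2' (3 * u) - FE2' u) / 2

/-- The second derivative of `𝓟 ∘ ofComplex`:
`P₂(u) = (27·2πi(2F F' − G')(3u)/12 − 2πi(2FF' − G')(u)/12)/2`. [folklore] -/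
def PE2 (u : ℂ) : ℂ :=
  (27 * (2 * π * Complex.I * (12⁻¹ * (2 * FE2 (3 * u) * FE2' (3 * u) - GE4' (3 * u)))) -
    2 * π * Complex.I * (12⁻¹ * (2 * FE2 u * FE2' u - GE4' u))) / 2

/-- `𝓟 ∘ ofComplex = (3F(3u) − F(u))/2`. [folklore] -/
theorem eisThree_ofComplex_eq {u : ℂ} (hu : 0 < u.im) : (eisThree ∘ ofComplex) u = (3 * FE2 (3 * u) - FE2 u) / 2 := by
  simp only [Function.comp_apply, eisThree, FE2, mulThree_ofComplex hu]

/-- **`(𝓟 ∘ ofComplex)' = P₁`.** [folklore] -/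
theorem hasDerivAt_eisThree_ofComplex {u : ℂ} (hu : 0 < u.im) : HasDerivAt (eisThree ∘ ofComplex) (PE1 u) u := by
  have hu3 : 0 < (3 * u).im := by simpa using hu
  have h3 : HasDerivAt (fun v : ℂ => FE2 (3 * v)) (FE2' (3 * u) * 3) u :=
    (hasDerivAt_FE2 hu3).comp u ((hasDerivAt_id u).const_mul 3 |>.congr_deriv (by simp))
  have h := ((h3.const_mul 3).sub (hasDerivAt_FE2 hu)).div_const 2
  have hev : (eisThree ∘ ofComplex) =ᶠ[𝓝 u] fun v => (3 * FE2 (3 * v) - FE2 v) / 2 := by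
    filter_upwards [isOpen_upperHalfPlaneSet.mem_nhds hu] with v hv using eisThree_ofComplex_eq hv
  refine (h.congr_of_eventuallyEq hev).congr_deriv ?_
  rw [PE1]; ring

/-- `F'` is differentiable with derivative `2πi(2FF' − G')/12`. [folklore] -/
theorem hasDerivAt_FE2' {u : ℂ} (hu : 0 < u.im) :
    HasDerivAt FE2' (2 * π * Complex.I * (12⁻¹ * (2 * FE2 u * FE2' u - GE4' u))) u := by
  have h := (((hasDerivAt_FE2 hu).mul (hasDerivAt_FE2 hu)).sub (hasDerivAt_GE4 hu)).const_mul (12⁻¹ : ℂ) |>.const_mul (2 * π * Complex.I)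
  refine (h.congr_of_eventuallyEq (Eventually.of_forall fun v => rfl)).congr_deriv ?_
  ring

/-- **`P₁' = P₂`.** [folklore] -/
theorem hasDerivAt_PE1 {u : ℂ} (hu : 0 < u.im) : HasDerivAt PE1 (PE2 u) u := by
  have hu3 : 0 < (3 * u).im := by simpa using hu
  have h3 : HasDerivAt (fun v : ℂ => FE2' (3 * v))
      (2 * π * Complex.I * (12⁻¹ * (2 * FE2 (3 * u) * FE2' (3 * u) - GE4' (3 * u))) * 3) u :=
    (hasDerivAt_FE2' hu3).comp u ((hasDerivAt_id u).const_mul 3 |>.congr_deriv (by simp))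
  have h := ((h3.const_mul 9).sub (hasDerivAt_FE2' hu)).div_const 2
  refine (h.congr_of_eventuallyEq (Eventually.of_forall fun v => rfl)).congr_deriv ?_
  rw [PE2]; ring

/-- `w³ = 3√3·i` and `w⁶ = −27`. [folklore] -/
theorem coe_wPt_pow : ((wPt : ℍ) : ℂ) ^ 3 = 3 * (Real.sqrt 3 : ℝ) * Complex.I ∧ ((wPt : ℍ) : ℂ) ^ 6 = -27 := by
  have hs : Real.sqrt 3 * Real.sqrt 3 = 3 := Real.mul_self_sqrt (by norm_num)
  have h3 : ((wPt : ℍ) : ℂ) ^ 3 = 3 * (Real.sqrt 3 : ℝ) * Complex.I := by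
    rw [coe_wPt]
    apply Complex.ext
    · simp [pow_succ, Complex.mul_re, Complex.mul_im]; linear_combination (9 / 8 : ℝ) * hs
    · simp [pow_succ, Complex.mul_re, Complex.mul_im]; linear_combination (-(Real.sqrt 3) / 8) * hs
  refine ⟨h3, ?_⟩
  rw [show 6 = 3 * 2 from rfl, pow_mul, h3]
  have : ((Real.sqrt 3 : ℝ) : ℂ) ^ 2 = 3 := by rw [sq]; exact_mod_cast hs
  ring_nf
  rw [Complex.I_sq, this]; ring

/-- Values at the corner: `F(3c₃) = 2√3/π`, `F(c₃) = 6√3/π`, `G(3c₃) = G(c₃) = 0`,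
`H(3c₃) = E₆(ρ)`, `H(c₃) = −27E₆(ρ)`. [folklore] -/
theorem corner_values :
    FE2 (3 * ((cmLevelThree : ℍ) : ℂ)) = ((2 * Real.sqrt 3 / π : ℝ) : ℂ) ∧
      FE2 ((cmLevelThree : ℍ) : ℂ) = ((6 * Real.sqrt 3 / π : ℝ) : ℂ) ∧
      GE4 (3 * ((cmLevelThree : ℍ) : ℂ)) = 0 ∧ GE4 ((cmLevelThree : ℍ) : ℂ) = 0 ∧
      HE6 (3 * ((cmLevelThree : ℍ) : ℂ)) = E₆ UpperHalfPlane.ρ ∧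
      HE6 ((cmLevelThree : ℍ) : ℂ) = -27 * E₆ UpperHalfPlane.ρ := by
  have hc : 0 < ((cmLevelThree : ℍ) : ℂ).im := cmLevelThree.im_pos
  have h3 : ofComplex (3 * ((cmLevelThree : ℍ) : ℂ)) = mulThree cmLevelThree := by
    rw [← mulThree_ofComplex hc, ofComplex_apply]
  have h1 : ofComplex ((cmLevelThree : ℍ) : ℂ) = cmLevelThree := ofComplex_apply _
  obtain ⟨hE4a, hE4b⟩ := E₄_mulThree_cmLevelThree
  refine ⟨?_, ?_, ?_, ?_, ?_, ?_⟩
  · simp only [FE2, Function.comp_apply, h3, E2_mulThree_cmLevelThree]; push_cast; ring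
  · simp only [FE2, Function.comp_apply, h1, E2_cmLevelThree]; push_cast; ring
  · simp only [GE4, Function.comp_apply, h3, hE4a]
  · simp only [GE4, Function.comp_apply, h1, hE4b]
  · simp only [HE6, Function.comp_apply, h3, mulThree_cmLevelThree]
    have h : (1 : ℝ) +ᵥ ((1 : ℝ) +ᵥ UpperHalfPlane.ρ) = (ModularGroup.T * ModularGroup.T) • UpperHalfPlane.ρ := by
      rw [mul_smul, ← UpperHalfPlane.modular_T_smul, ← UpperHalfPlane.modular_T_smul]
    rw [h, levelOne_apply_smul E₆]
    have hd : denom ((ModularGroup.T * ModularGroup.T : SL(2, ℤ)) : GL (Fin 2) ℝ) UpperHalfPlane.ρ = 1 := by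
      rw [ModularGroup.denom_apply]; simp [ModularGroup.T, Matrix.mul_apply, Fin.sum_univ_two]
    rw [hd, one_zpow, one_mul]
  · simp only [HE6, Function.comp_apply, h1]
    rw [cmLevelThree_eq_S_smul_wPt, levelOne_apply_smul E₆, ModularGroup.denom_S]
    have hw : E₆ wPt = E₆ UpperHalfPlane.ρ := by
      have h : wPt = ModularGroup.T⁻¹ • UpperHalfPlane.ρ := by
        have := UpperHalfPlane.modular_T_zpow_smul UpperHalfPlane.ρ (-1)
        rw [zpow_neg_one] at this
        rw [wPt, this]; norm_num
      rw [h, levelOne_apply_smul E₆]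
      have hd : denom ((ModularGroup.T⁻¹ : SL(2, ℤ)) : GL (Fin 2) ℝ) UpperHalfPlane.ρ = 1 := by
        rw [ModularGroup.denom_apply]; simp [ModularGroup.T, Matrix.SpecialLinearGroup.coe_inv, Matrix.adjugate_fin_two]
      rw [hd, one_zpow, one_mul]
    rw [hw, zpow_ofNat, coe_wPt_pow.2]

/-- **`𝓟'(c₃) = 0`** (`9E₂(3c₃)² = E₂(c₃)²`, `E₄(3c₃) = E₄(c₃) = 0`). [cite: Zhou2015, Remark 9] -/
theorem PE1_cmLevelThree : PE1 ((cmLevelThree : ℍ) : ℂ) = 0 := by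
  obtain ⟨hF3, hF1, hG3, hG1, -, -⟩ := corner_values
  rw [PE1, FE2', FE2', hF3, hF1, hG3, hG1]
  have hπ : (π : ℂ) ≠ 0 := by exact_mod_cast Real.pi_ne_zero
  push_cast
  field_simp
  ring

/-- **`𝓟''(c₃) = −3π²E₆(ρ)`.** [cite: Zhou2015, Remark 9] -/
theorem PE2_cmLevelThree : PE2 ((cmLevelThree : ℍ) : ℂ) = -3 * π ^ 2 * E₆ UpperHalfPlane.ρ := by
  obtain ⟨hF3, hF1, hG3, hG1, hH3, hH1⟩ := corner_values
  rw [PE2, FE2', FE2', GE4', GE4', hF3, hF1, hG3, hG1, hH3, hH1]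
  have hπ : (π : ℂ) ≠ 0 := by exact_mod_cast Real.pi_ne_zero
  have hs : Real.sqrt 3 * Real.sqrt 3 = 3 := Real.mul_self_sqrt (by norm_num)
  push_cast
  field_simp
  ring_nf
  rw [Complex.I_sq]
  ring

end CornerDerivatives

/-! ## Signs at the corner: `E₆(ρ) > 0` and `η(ρ − 1)¹² ∈ iℝ₊` -/

section CornerSigns

open Literature.NumberTheory.EllipticCurves.ModularForms (tendsto_E6_atImInfty E₆_eq_zero_iff)
open Literature.Barriers.Schanuel (hasSum_E₆)

/-- Points `−3/2 + iy` of the vertical line through `w = ρ − 1`. [folklore] -/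
def linePt (y : ℝ) (hy : 0 < y) : ℍ := ⟨⟨-3 / 2, y⟩, hy⟩

/-- `w = linePt (√3/2)`. [folklore] -/
theorem wPt_eq_linePt : wPt = linePt (Real.sqrt 3 / 2) (by positivity) := by
  apply UpperHalfPlane.ext; rw [coe_wPt]; rfl

/-- On the line, `q = e^{2πiτ} = −e^{−2πy}` is real. [folklore] -/
theorem cexp_linePt (y : ℝ) (hy : 0 < y) :
    cexp (2 * π * Complex.I * (linePt y hy : ℂ)) = ((-Real.exp (-2 * π * y) : ℝ) : ℂ) := by
  have h : 2 * π * Complex.I * (linePt y hy : ℂ) = ((-2 * π * y : ℝ) : ℂ) + (-1 : ℤ) * (2 * π * Complex.I) - π * Complex.I := by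
    show 2 * π * Complex.I * (⟨-3 / 2, y⟩ : ℂ) = _
    apply Complex.ext
    · simp
    · simp; ring
  rw [h, Complex.exp_sub, Complex.exp_add, Complex.exp_int_mul_two_pi_mul_I, Complex.exp_pi_mul_I]
  push_cast
  ring

/-- `E₆` is real on the line. [folklore] -/
theorem E₆_linePt_im (y : ℝ) (hy : 0 < y) : (E₆ (linePt y hy)).im = 0 := by
  have h := hasSum_E₆ (linePt y hy)
  rw [cexp_linePt] at h
  have him := h.mapL Complex.imCLM
  simp only [Complex.imCLM_apply] at him
  have h0 : (fun m : ℕ => (PowerSeries.coeff m (Literature.Barriers.Schanuel.ramanujanRSeries.map (Int.castRingHom ℂ)) *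
      (((-Real.exp (-2 * π * y) : ℝ) : ℂ)) ^ m).im) = fun _ => 0 := by
    funext m
    rw [PowerSeries.coeff_map, eq_intCast, ← Complex.ofReal_pow, ← Complex.ofReal_intCast, ← Complex.ofReal_mul,
      Complex.ofReal_im]
  rw [h0] at him
  exact him.unique hasSum_zero

/-- `E₆ ≠ 0` on the line above height `½` (the orbit of `i` meets `{Im > ½}` only in `i + ℤ`). [folklore] -/
theorem E₆_linePt_ne_zero {y : ℝ} (hy : 1 / 2 < y) : E₆ (linePt y (by linarith)) ≠ 0 := by
  intro h0
  obtain ⟨γ, hγ⟩ := E₆_eq_zero_iff.mp h0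
  -- `Im(γ•i) = 1/(c² + d²) = y > 1/2`
  have him : (γ • UpperHalfPlane.I).im = y := by rw [hγ]; rfl
  rw [im_smul_eq] at him
  simp only [Complex.normSq_apply, Complex.add_re, Complex.mul_re, Complex.intCast_re, UpperHalfPlane.coe_re,
    UpperHalfPlane.I_re, mul_zero, Complex.intCast_im, UpperHalfPlane.coe_im, UpperHalfPlane.I_im, mul_one, sub_zero,
    zero_add, Complex.add_im, Complex.mul_im, add_zero, UpperHalfPlane.I_im] at him
  have hpos : (0 : ℝ) < ((γ 1 1 : ℤ) : ℝ) * ((γ 1 1 : ℤ) : ℝ) + ((γ 1 0 : ℤ) : ℝ) * ((γ 1 0 : ℤ) : ℝ) := by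
    by_contra hle
    push Not at hle
    have : (1 : ℝ) / _ ≤ 0 := div_nonpos_of_nonneg_of_nonpos zero_le_one hle
    linarith
  have hlt : ((γ 1 1 : ℤ) : ℝ) * ((γ 1 1 : ℤ) : ℝ) + ((γ 1 0 : ℤ) : ℝ) * ((γ 1 0 : ℤ) : ℝ) < 2 := by
    rw [div_eq_iff hpos.ne'] at him
    nlinarith
  have hlt' : (γ 1 0) ^ 2 + (γ 1 1) ^ 2 < 2 := by
    have : (((γ 1 0) ^ 2 + (γ 1 1) ^ 2 : ℤ) : ℝ) < 2 := by push_cast; nlinarith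
    exact_mod_cast this
  obtain ⟨n, hn⟩ := smul_I_eq_vadd_of_sq_add_sq_lt_two γ hlt'
  have hre : (γ • UpperHalfPlane.I).re = -3 / 2 := by rw [hγ]; rfl
  rw [hn, UpperHalfPlane.vadd_re, UpperHalfPlane.I_re, add_zero] at hre
  have h2 : (2 : ℤ) * n = -3 := by exact_mod_cast (by linarith : (2 : ℝ) * n = -3)
  omega

/-- The line tends to `i∞`. [folklore] -/
theorem tendsto_linePt : Tendsto (fun y : Set.Ioi (1 / 2 : ℝ) => linePt y.1 (by linarith [y.2.out])) atTop atImInfty := by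
  rw [atImInfty, tendsto_comap_iff]
  have : (UpperHalfPlane.im ∘ fun y : Set.Ioi (1 / 2 : ℝ) => linePt y.1 (by linarith [y.2.out])) = fun y => y.1 := by
    funext y; rfl
  rw [this]
  exact tendsto_atTop_atTop.mpr fun b =>
    ⟨⟨max b 1, lt_of_lt_of_le (by norm_num) (le_max_right b 1)⟩, fun y hy => le_trans (le_max_left _ _) hy⟩

/-- **`E₆ > 0` on the line `Re τ = −3/2`, `Im τ > ½`** (real, non-vanishing, `→ 1`). [folklore] -/
theorem E₆_linePt_re_pos {y : ℝ} (hy : 1 / 2 < y) : 0 < (E₆ (linePt y (by linarith))).re := by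
  -- the real-valued function `g(y) = Re E₆(−3/2 + iy)` on `(1/2, ∞)`
  set g : ℝ → ℝ := fun t => (((E₆ : ℍ → ℂ) ∘ ofComplex) ⟨-3 / 2, t⟩).re with hg
  have hg_eq : ∀ t : ℝ, (ht : 1 / 2 < t) → g t = (E₆ (linePt t (by linarith))).re := by
    intro t ht
    simp only [hg, Function.comp_apply]
    congr 2
    exact ofComplex_apply_of_im_pos (by show (0:ℝ) < t; linarith)
  have hcont : ContinuousOn g (Set.Ioi (1 / 2)) := by
    intro t ht
    have ht' : (0 : ℝ) < t := by linarith [ht.out]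
    have hd : DifferentiableAt ℂ ((E₆ : ℍ → ℂ) ∘ ofComplex) ⟨-3 / 2, t⟩ :=
      (UpperHalfPlane.mdifferentiable_iff.mp (ModularFormClass.holo E₆)).differentiableAt
        (isOpen_upperHalfPlaneSet.mem_nhds (by simpa using ht'))
    have hline : Continuous fun t : ℝ => (⟨-3 / 2, t⟩ : ℂ) := by
      have : (fun t : ℝ => (⟨-3 / 2, t⟩ : ℂ)) = fun t : ℝ => (-3 / 2 : ℂ) + (t : ℂ) * Complex.I := by
        funext t; apply Complex.ext <;> simp
      rw [this]; fun_prop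
    exact (Complex.continuous_re.continuousAt.comp (hd.continuousAt.comp hline.continuousAt)).continuousWithinAt
  have hne : ∀ t : ℝ, (ht : 1 / 2 < t) → g t ≠ 0 := by
    intro t ht h0
    apply E₆_linePt_ne_zero ht
    apply Complex.ext
    · rw [← hg_eq t ht, h0]; rfl
    · rw [E₆_linePt_im]; rfl
  -- `g → 1` at `∞`, hence `g(t₁) > 0` for some large `t₁`
  have hlim : Tendsto (fun s : Set.Ioi (1 / 2 : ℝ) => g s.1) atTop (𝓝 1) := by
    have h := (Complex.continuous_re.tendsto 1).comp (tendsto_E6_atImInfty.comp tendsto_linePt)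
    rw [Complex.one_re] at h
    refine h.congr fun s => ?_
    simp only [Function.comp_apply]
    rw [hg_eq s.1 s.2.out]
  have hev := hlim.eventually (Ioi_mem_nhds (by norm_num : (0 : ℝ) < 1))
  rw [Filter.eventually_atTop] at hev
  obtain ⟨⟨t₀, ht₀⟩, ht₀'⟩ := hev
  -- compare `y` with `t₁ := max y t₀`
  by_contra hneg
  push Not at hneg
  have hgy : g y < 0 := lt_of_le_of_ne (by rwa [hg_eq y hy]) (hne y hy)
  set t₁ := max y t₀ with ht₁
  have hgt₁ : 0 < g t₁ := ht₀' ⟨t₁, lt_of_lt_of_le hy (le_max_left _ _)⟩ (Subtype.mk_le_mk.mpr (le_max_right _ _))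
  -- IVT on `[y, t₁]`
  have hsub : Set.Icc y t₁ ⊆ Set.Ioi (1 / 2) := fun t ht => lt_of_lt_of_le hy ht.1
  have hivt := intermediate_value_Icc (le_max_left y t₀) (hcont.mono hsub)
  obtain ⟨c, hc, hc0⟩ := hivt ⟨hgy.le, hgt₁.le⟩
  exact hne c (lt_of_lt_of_le hy hc.1) hc0

/-- **`E₆(w) = E₆(ρ)` is real and positive.** [folklore] -/
theorem E₆_wPt_pos : (E₆ wPt).im = 0 ∧ 0 < (E₆ wPt).re := by
  have hy : (1 : ℝ) / 2 < Real.sqrt 3 / 2 := by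
    have : (1 : ℝ) < Real.sqrt 3 := by
      rw [show (1 : ℝ) = Real.sqrt 1 from Real.sqrt_one.symm]
      exact Real.sqrt_lt_sqrt zero_le_one (by norm_num)
    linarith
  rw [wPt_eq_linePt]
  exact ⟨E₆_linePt_im _ _, E₆_linePt_re_pos hy⟩

/-- The eta product `∏(1 − qⁿ)` at `w`: real and positive (`q = −e^{−π√3} ∈ (−1, 0)`). [folklore] -/
theorem eta_tprod_wPt_pos :
    (∏' n : ℕ, (1 - eta_q n (wPt : ℂ))).im = 0 ∧ 0 < (∏' n : ℕ, (1 - eta_q n (wPt : ℂ))).re := by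
  have hw : (wPt : ℂ) ∈ upperHalfPlaneSet := wPt.2
  set r : ℝ := -Real.exp (-2 * π * (Real.sqrt 3 / 2)) with hr
  have hq : cexp (2 * π * Complex.I * (wPt : ℂ)) = (r : ℂ) := by
    rw [wPt_eq_linePt]; exact cexp_linePt _ _
  have hr1 : |r| < 1 := by
    rw [hr, abs_neg, abs_of_pos (Real.exp_pos _), ← Real.exp_zero, Real.exp_lt_exp]
    have := Real.pi_pos
    have : 0 < Real.sqrt 3 := Real.sqrt_pos.mpr (by norm_num)
    nlinarith
  -- each factor is the real number `1 − r^{n+1} > 0`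
  have hfac : ∀ n : ℕ, 1 - eta_q n (wPt : ℂ) = ((1 - r ^ (n + 1) : ℝ) : ℂ) := by
    intro n; rw [ModularForm.eta_q_eq_pow, hq]; push_cast; ring
  have hfac_pos : ∀ n : ℕ, 0 < 1 - r ^ (n + 1) := by
    intro n
    have : |r ^ (n + 1)| < 1 := by rw [abs_pow]; exact pow_lt_one₀ (abs_nonneg _) hr1 (Nat.succ_ne_zero _)
    linarith [(abs_lt.mp this).2]
  have hmul : Multipliable fun n : ℕ => 1 - eta_q n (wPt : ℂ) :=
    (ModularForm.multipliableLocallyUniformlyOn_eta.multipliable hw)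
  have hlim := hmul.tendsto_prod_tprod_nat
  -- partial products are real and positive
  have hpart : ∀ N : ℕ, (∏ n ∈ Finset.range N, (1 - eta_q n (wPt : ℂ))) = ((∏ n ∈ Finset.range N, (1 - r ^ (n + 1)) : ℝ) : ℂ) := by
    intro N; rw [Complex.ofReal_prod]; exact Finset.prod_congr rfl fun n _ => hfac n
  have him : (∏' n : ℕ, (1 - eta_q n (wPt : ℂ))).im = 0 := by
    have h := (Complex.continuous_im.tendsto _).comp hlim
    have h0 : (Complex.im ∘ fun N : ℕ => ∏ n ∈ Finset.range N, (1 - eta_q n (wPt : ℂ))) = fun _ => 0 := by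
      funext N; simp only [Function.comp_apply, hpart, Complex.ofReal_im]
    rw [h0] at h
    exact tendsto_nhds_unique h tendsto_const_nhds
  have hre : 0 ≤ (∏' n : ℕ, (1 - eta_q n (wPt : ℂ))).re := by
    have h := (Complex.continuous_re.tendsto _).comp hlim
    refine ge_of_tendsto' h fun N => ?_
    simp only [Function.comp_apply, hpart, Complex.ofReal_re]
    exact Finset.prod_nonneg fun n _ => (hfac_pos n).le
  have hne : (∏' n : ℕ, (1 - eta_q n (wPt : ℂ))) ≠ 0 := ModularForm.eta_tprod_ne_zero hw
  refine ⟨him, lt_of_le_of_ne hre fun h0 => hne (Complex.ext (by rw [← h0]; rfl) (by rw [him]; rfl))⟩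

/-- `(𝕢₂₄ w)¹² = e^{πiw} = i·e^{−π√3/2}`. [folklore] -/
theorem qParam_wPt_pow_twelve :
    (Function.Periodic.qParam 24 (wPt : ℂ)) ^ 12 = Complex.I * ((Real.exp (-(π * Real.sqrt 3 / 2)) : ℝ) : ℂ) := by
  have h : (12 : ℂ) * (2 * π * Complex.I * (wPt : ℂ) / 24) =
      (π / 2 : ℂ) * Complex.I + ((-(π * Real.sqrt 3 / 2) : ℝ) : ℂ) + (-1 : ℤ) * (2 * π * Complex.I) := by
    rw [coe_wPt]
    apply Complex.ext
    · simp; ring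
    · simp; ring
  calc (Function.Periodic.qParam 24 (wPt : ℂ)) ^ 12 = cexp (12 * (2 * π * Complex.I * (wPt : ℂ) / 24)) := by
        rw [Function.Periodic.qParam, ← Complex.exp_nat_mul]; push_cast; ring_nf
    _ = cexp ((π / 2 : ℂ) * Complex.I + ((-(π * Real.sqrt 3 / 2) : ℝ) : ℂ) + (-1 : ℤ) * (2 * π * Complex.I)) := by rw [h]
    _ = Complex.I * ((Real.exp (-(π * Real.sqrt 3 / 2)) : ℝ) : ℂ) := by
        rw [Complex.exp_add, Complex.exp_add, Complex.exp_int_mul_two_pi_mul_I, Complex.exp_pi_div_two_mul_I,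
          Complex.ofReal_exp]
        ring

end CornerSigns

/-! ## The corner constant: `Δ₃(c₃) = 𝓟''(c₃)/(24π²)` -/

section CornerConstant

open Literature.NumberTheory.Automorphic (cmLevelThree)
open Literature.NumberTheory.EllipticCurves.ModularForms (E₄_eq_zero_iff levelOne_apply_smul)

/-- `w = T⁻¹ • ρ`. [folklore] -/
theorem wPt_eq_T_inv_smul : wPt = ModularGroup.T⁻¹ • UpperHalfPlane.ρ := by
  have := UpperHalfPlane.modular_T_zpow_smul UpperHalfPlane.ρ (-1)
  rw [zpow_neg_one] at this
  rw [wPt, this]; norm_num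

/-- `E₄(w) = 0`, `E₆(w) = E₆(ρ)`. [folklore] -/
theorem E₄_wPt_E₆_wPt : E₄ wPt = 0 ∧ E₆ wPt = E₆ UpperHalfPlane.ρ := by
  constructor
  · rw [wPt_eq_T_inv_smul]; exact E₄_eq_zero_iff.mpr ⟨_, rfl⟩
  · rw [wPt_eq_T_inv_smul, levelOne_apply_smul E₆]
    have hd : denom ((ModularGroup.T⁻¹ : SL(2, ℤ)) : GL (Fin 2) ℝ) UpperHalfPlane.ρ = 1 := by
      rw [ModularGroup.denom_apply]; simp [ModularGroup.T, Matrix.SpecialLinearGroup.coe_inv, Matrix.adjugate_fin_two]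
    rw [hd, one_zpow, one_mul]

/-- `E₆(w)² = −1728·η(w)²⁴` (`1728Δ = E₄³ − E₆²`, `Δ = η²⁴`, `E₄(w) = 0`). [folklore] -/
theorem E₆_wPt_sq : E₆ wPt ^ 2 = -1728 * η (wPt : ℂ) ^ 24 := by
  have h := ModularForm.discriminant_eq_E₄_cube_sub_E₆_sq wPt
  rw [E₄_wPt_E₆_wPt.1] at h
  have h' : ModularForm.discriminant wPt = η (wPt : ℂ) ^ 24 := rfl
  rw [h'] at h
  linear_combination (1728 : ℂ) * h

/-- **`η(w)¹² = i·r₀` with `r₀ > 0`.** [folklore] -/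
theorem eta_wPt_pow_twelve : ∃ r₀ : ℝ, 0 < r₀ ∧ η (wPt : ℂ) ^ 12 = Complex.I * (r₀ : ℂ) := by
  obtain ⟨him, hre⟩ := eta_tprod_wPt_pos
  set P := ∏' n : ℕ, (1 - eta_q n (wPt : ℂ)) with hP
  have hPr : P = ((P.re : ℝ) : ℂ) := Complex.ext rfl (by rw [him]; rfl)
  refine ⟨Real.exp (-(π * Real.sqrt 3 / 2)) * P.re ^ 12, mul_pos (Real.exp_pos _) (pow_pos hre _), ?_⟩
  have hη : η (wPt : ℂ) = Function.Periodic.qParam 24 (wPt : ℂ) * P := rfl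
  rw [hη, mul_pow, qParam_wPt_pow_twelve, hPr]
  push_cast
  simp only [Complex.ofReal_re]
  ring

/-- **`E₆(w) = −24√3·i·η(w)¹²`** (the positive square root: `E₆(w) > 0`, `η(w)¹² ∈ iℝ₊`). [folklore] -/
theorem E₆_wPt_eq : E₆ wPt = -24 * (Real.sqrt 3 : ℝ) * Complex.I * η (wPt : ℂ) ^ 12 := by
  obtain ⟨r₀, hr₀, hη⟩ := eta_wPt_pow_twelve
  obtain ⟨him, hre⟩ := E₆_wPt_pos
  have hsq := E₆_wPt_sq
  rw [show (24 : ℕ) = 12 * 2 from rfl, pow_mul, hη] at hsq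
  -- `E₆(w) = e` real with `e² = 1728 r₀²`, `e > 0` ⇒ `e = 24√3 r₀`
  have hE : E₆ wPt = (((E₆ wPt).re : ℝ) : ℂ) := Complex.ext rfl (by rw [him]; rfl)
  set e : ℝ := (E₆ wPt).re with he
  rw [hE] at hsq ⊢
  have h1 : (e : ℂ) ^ 2 = ((1728 * r₀ ^ 2 : ℝ) : ℂ) := by
    rw [hsq]; push_cast; ring_nf; rw [Complex.I_sq]; ring
  have h2 : e ^ 2 = 1728 * r₀ ^ 2 := by exact_mod_cast h1
  have hs : Real.sqrt 3 * Real.sqrt 3 = 3 := Real.mul_self_sqrt (by norm_num)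
  have hs0 : 0 < Real.sqrt 3 := Real.sqrt_pos.mpr (by norm_num)
  have h3 : e = 24 * Real.sqrt 3 * r₀ := by
    have : (e - 24 * Real.sqrt 3 * r₀) * (e + 24 * Real.sqrt 3 * r₀) = 0 := by nlinarith
    rcases mul_eq_zero.mp this with h | h
    · linarith
    · nlinarith [mul_pos hs0 hr₀]
  rw [h3, hη]; push_cast; ring_nf; rw [Complex.I_sq]; ring

/-- `(e^{−πi/4})⁶ = i` and `(e^{2πi/24})¹⁸ = −i`. [folklore] -/
theorem root_units : cexp (-(π * Complex.I / 4)) ^ 6 = Complex.I ∧ cexp (2 * π * Complex.I / 24) ^ 18 = -Complex.I := by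
  constructor
  · rw [← Complex.exp_nat_mul, show ((6 : ℕ) : ℂ) * -(π * Complex.I / 4) = (π / 2) * Complex.I + (-1 : ℤ) * (2 * π * Complex.I) by
      push_cast; ring, Complex.exp_add, Complex.exp_int_mul_two_pi_mul_I, Complex.exp_pi_div_two_mul_I, mul_one]
  · rw [← Complex.exp_nat_mul, show ((18 : ℕ) : ℂ) * (2 * π * Complex.I / 24) = (π / 2) * Complex.I + π * Complex.I by
      push_cast; ring, Complex.exp_add, Complex.exp_pi_div_two_mul_I, Complex.exp_pi_mul_I, mul_neg, mul_one]

/-- `3c₃ = w + 3` in coordinates. [folklore] -/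
theorem coe_mulThree_cmLevelThree : ((mulThree cmLevelThree : ℍ) : ℂ) = (wPt : ℂ) + 3 := by
  rw [coe_mulThree, coe_cmLevelThree, coe_wPt]
  apply Complex.ext
  · simp; norm_num
  · simp; ring

/-- **`Δ₃(c₃) = 3√3·i·η(w)¹²`.** [folklore] -/
theorem deltaThree_cmLevelThree : deltaThree cmLevelThree = 3 * (Real.sqrt 3 : ℝ) * Complex.I * η (wPt : ℂ) ^ 12 := by
  rw [deltaThree, coe_mulThree_cmLevelThree, eta_add_three, cmLevelThree_eq_S_smul_wPt, eta_S_smul]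
  obtain ⟨u6, u18⟩ := root_units
  have hw3 := coe_wPt_pow.1
  have hsq : Complex.sqrt (wPt : ℂ) ^ 6 = (wPt : ℂ) ^ 3 := by
    rw [show (6 : ℕ) = 2 * 3 from rfl, pow_mul, csqrt_sq]
  calc (cexp (-(π * Complex.I / 4)) * Complex.sqrt (wPt : ℂ) * η (wPt : ℂ) *
        (cexp (2 * π * Complex.I / 24) ^ 3 * η (wPt : ℂ))) ^ 6
      = cexp (-(π * Complex.I / 4)) ^ 6 * (cexp (2 * π * Complex.I / 24)) ^ 18 * Complex.sqrt (wPt : ℂ) ^ 6 *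
          η (wPt : ℂ) ^ 12 := by ring
    _ = 3 * (Real.sqrt 3 : ℝ) * Complex.I * η (wPt : ℂ) ^ 12 := by
        rw [u6, u18, hsq, hw3]
        linear_combination (-(3 : ℂ) * (Real.sqrt 3 : ℝ) * η (wPt : ℂ) ^ 12 * Complex.I) * Complex.I_sq

/-- **The corner constant: `Δ₃(c₃) = 𝓟''(c₃)/(24π²)`**, i.e. `2Δ₃(c₃)/𝓟''(c₃) = 1/(12π²)`. [cite: Zhou2015, Remark 9] -/
theorem deltaThree_cmLevelThree_eq_PE2 :
    deltaThree cmLevelThree = (24 * (π : ℂ) ^ 2)⁻¹ * PE2 ((cmLevelThree : ℍ) : ℂ) := by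
  rw [deltaThree_cmLevelThree, PE2_cmLevelThree, ← E₄_wPt_E₆_wPt.2, E₆_wPt_eq]
  have hπ : (π : ℂ) ≠ 0 := by exact_mod_cast Real.pi_ne_zero
  field_simp

end CornerConstant

end Literature.NumberTheory.ModularForms

end
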